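import Mathlib.MeasureTheory.Integral.Marginal
import Literature.MathematicalPhysics.KineticTheory.InfiniteChainGibbsMomenta
import HarnessLib

/-!
# The one-site law of the transfer-operator Markov chain has mass one

Topic `Literature/MathematicalPhysics/KineticTheory`; theorems only (no definitions, no named
facts). Companion of `InfiniteChainMarkovKernel.lean` / `InfiniteChainMarkovDensity.lean`: the
one-site window density `ρ_{a,a}(σ) = ψ(q_a)² e^{-U(q_a)/T} (2πT)^{-1/2} e^{-p_a²/(2T)}` of the
stationary chain of Cassandro–Olivieri–Pellegrinotti–Presutti (1978), §2 integrates to one over the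
site `a` (normalisation `∫ ψ² e^{-U/T} = 1` of the transfer eigenfunction, Gaussian momentum of
mass one) — the base case (C1) of the consistency/normalisation of the window laws, in Mathlib's
`lmarginal` form.

* `lintegral_oneSiteDensity_eq_one` — `∫⁻_{ℝ×ℝ} ψ(q)² e^{-U(q)/T} (2πT)^{-1/2} e^{-p²/(2T)} = 1`;
* `lmarginal_singleton_oneSiteDensity` — `(∫⋯∫⁻_{ {a} }, ρ_{a,a}) η = 1` for every `η`.

## References

* M. Cassandro, E. Olivieri, A. Pellegrinotti, E. Presutti, Z. Wahrsch. verw. Gebiete 41 (1978)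
  313–334, §2.
* H.-O. Georgii, *Gibbs Measures and Phase Transitions* (2011), §3.1. [Georgii2011]
-/

noncomputable section

open MeasureTheory Filter Set Function
open scoped ENNReal

namespace Literature.MathematicalPhysics.KineticTheory.HeatConduction

namespace OscillatorChain

variable (P : OscillatorChain)

/-- **The one-site density has mass one**: if `∫ e^{-U(q)/T} ψ(q)² dq = 1` (integrable integrand)
and `T > 0`, then `∫⁻_{ℝ×ℝ} ψ(q)² e^{-U(q)/T} (2πT)^{-1/2} e^{-p²/(2T)} d(q,p) = 1` (Tonelli; Gaussian
mass one, `lintegral_gaussWeight`) (Georgii 2011, §3.1: the invariant one-site law).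
[cite: Georgii2011, §3.1] -/
theorem lintegral_oneSiteDensity_eq_one {T : ℝ} (hT : 0 < T) {ψ : ℝ → ℝ}
    (hint : Integrable fun q => Real.exp (-T⁻¹ * P.U q) * ψ q ^ 2)
    (hnorm : ∫ q, Real.exp (-T⁻¹ * P.U q) * ψ q ^ 2 = 1) :
    ∫⁻ z : ℝ × ℝ, ENNReal.ofReal (ψ z.1 ^ 2 * (Real.exp (-T⁻¹ * P.U z.1) *
        ((Real.sqrt (2 * Real.pi * T))⁻¹ * Real.exp (-z.2 ^ 2 / (2 * T))))) = 1 := by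
  have hs : 0 < Real.sqrt (2 * Real.pi * T) := Real.sqrt_pos.2 (by positivity)
  -- factorise the integrand
  have hsplit : ∀ z : ℝ × ℝ, ENNReal.ofReal (ψ z.1 ^ 2 * (Real.exp (-T⁻¹ * P.U z.1) *
      ((Real.sqrt (2 * Real.pi * T))⁻¹ * Real.exp (-z.2 ^ 2 / (2 * T))))) =
      ENNReal.ofReal (Real.exp (-T⁻¹ * P.U z.1) * ψ z.1 ^ 2) *
        ENNReal.ofReal ((Real.sqrt (2 * Real.pi * T))⁻¹ * Real.exp (-z.2 ^ 2 / (2 * T))) := by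
    intro z
    rw [← ENNReal.ofReal_mul (by positivity)]
    congr 1
    ring
  simp_rw [hsplit]
  have hf : AEMeasurable (fun q : ℝ => ENNReal.ofReal (Real.exp (-T⁻¹ * P.U q) * ψ q ^ 2)) volume :=
    ENNReal.measurable_ofReal.comp_aemeasurable hint.aestronglyMeasurable.aemeasurable
  have hg : AEMeasurable (fun p : ℝ => ENNReal.ofReal ((Real.sqrt (2 * Real.pi * T))⁻¹ *
      Real.exp (-p ^ 2 / (2 * T)))) volume :=
    (ENNReal.measurable_ofReal.comp (by fun_prop)).aemeasurable
  rw [Measure.volume_eq_prod, lintegral_prod_mul hf hg]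
  have hpos : ∫⁻ q, ENNReal.ofReal (Real.exp (-T⁻¹ * P.U q) * ψ q ^ 2) = 1 := by
    rw [← ofReal_integral_eq_lintegral_ofReal hint
      (Eventually.of_forall fun q => by positivity), hnorm, ENNReal.ofReal_one]
  have hmom : ∫⁻ p, ENNReal.ofReal ((Real.sqrt (2 * Real.pi * T))⁻¹ *
      Real.exp (-p ^ 2 / (2 * T))) = 1 := by
    have h1 : ∀ p, ENNReal.ofReal ((Real.sqrt (2 * Real.pi * T))⁻¹ * Real.exp (-p ^ 2 / (2 * T))) =
        ENNReal.ofReal ((Real.sqrt (2 * Real.pi * T))⁻¹) * gaussWeight T p := fun p => by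
      rw [gaussWeight, ← ENNReal.ofReal_mul (inv_nonneg.2 hs.le)]
    simp_rw [h1]
    rw [lintegral_const_mul _ (measurable_gaussWeight T), lintegral_gaussWeight hT,
      ← ENNReal.ofReal_mul (inv_nonneg.2 hs.le), inv_mul_cancel₀ hs.ne', ENNReal.ofReal_one]
  rw [hpos, hmom, one_mul]

/-- **(C1) The one-site window law has mass one, in `lmarginal` form**: for every `a ∈ ℤ` and
every frozen configuration `η`, `(∫⋯∫⁻_{ {a} }, ρ_{a,a}) η = 1`, where
`ρ_{a,a}(σ) = ψ(q_a)² e^{-U(q_a)/T} (2πT)^{-1/2} e^{-p_a²/(2T)}` (Mathlib `lmarginal_singleton`).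
[cite: Georgii2011, §3.1] -/
theorem lmarginal_singleton_oneSiteDensity {T : ℝ} (hT : 0 < T) {ψ : ℝ → ℝ}
    (hint : Integrable fun q => Real.exp (-T⁻¹ * P.U q) * ψ q ^ 2)
    (hnorm : ∫ q, Real.exp (-T⁻¹ * P.U q) * ψ q ^ 2 = 1) (a : ℤ) (η : ChainConfig) :
    (∫⋯∫⁻_{a}, (fun σ : ChainConfig => ENNReal.ofReal (ψ (σ a).1 ^ 2 *
        (Real.exp (-T⁻¹ * P.U (σ a).1) *
          ((Real.sqrt (2 * Real.pi * T))⁻¹ * Real.exp (-(σ a).2 ^ 2 / (2 * T))))))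
      ∂fun _ : ℤ => (volume : Measure (ℝ × ℝ))) η = 1 := by
  rw [lmarginal_singleton]
  simp only [Function.update_self]
  exact P.lintegral_oneSiteDensity_eq_one hT hint hnorm

end OscillatorChain

end Literature.MathematicalPhysics.KineticTheory.HeatConduction
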